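import Literature.Probability.LatticeModels.AnisotropicPlaneRotatorLROInfrared
import Literature.Probability.LatticeModels.LatticeGreenHeatKernel
import HarnessLib

/-!
# An explicit logarithmic bound on Fröhlich–Israel–Lieb–Simon's constant for the layered dispersion: `C(r) = (2π)⁻³∫ d³q/E^r_q ≤ 3 + ln(1/r)`

Topic `Probability/LatticeModels`; makes the interlayer ordering floor of
`AnisotropicPlaneRotatorLROInfrared.lean` (`layered_longRangeOrder_infraredBound`: the layered
classical XY model on `(ℤ/Lℤ)³` orders once `J∥ > C(J⊥/J∥)`, `C(r) = (2π)⁻³∫_{[-π,π]³} d³q/E^r_q`,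
`E^r_q = 2 − cos q₁ − cos q₂ + r(1 − cos q₃)`, Kennedy–Lieb–Shastry's (7)) EXPLICIT:

* `AnisotropicRotator.setIntegral_inv_anisoDispersion_eq` — the heat-kernel (Laplace) representation
  `∫_{[-π,π]^d} dp/ε_K(p) = ∫₀^∞ ∏ᵢ B(tK_i) dt`, `B(s) = ∫_{-π}^{π} e^{−s(1−cos k)}dk = 2πe^{−s}I₀(s)`
  (`besselFactor`), for `d ≥ 3`, `K_i ≥ m > 0` (Fubini–Tonelli exactly as in the tree's
  `latticeGreen_eq_integral_prod_srwHeatKernel`, the isotropic case);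
* `AnisotropicRotator.klsConstant_le_sharp` / `klsConstant_le`: **`C(r) ≤ 1 + π/4 + (π/8)ln(1/r) ≤
  3 + ln(1/r)` for `0 < r ≤ 1`**, from `B(s) ≤ 2π`, `B(s)² ≤ π³/(2s)`, `B(s) ≤ 2πs^{-1/2}` (`s ≥ 1`)
  (the tree's Gaussian comparison through Jordan's inequality, `exp_neg_mul_one_sub_cos_le`) and a
  three-piece estimate of `∫₀^∞ B(t)²B(rt)dt` split at `t = 1`, `t = 1/r`;
* `AnisotropicRotator.layered_longRangeOrder_explicit`: for `0 < J⊥ ≤ J∥` and `ε > 0`, for all large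
  even `L`, `L⁻⁶∑_{x,y}⟨cos(θ_x − θ_y)⟩_{(J∥,J∥,J⊥)} ≥ 1 − (3 + ln(J∥/J⊥))/J∥ − ε` — the layered classical
  XY model has long-range order as soon as **`J∥ > 3 + ln(J∥/J⊥)`** (`layered_longRangeOrder_explicit_sharp`:
  `J∥ > 1 + π/4 + (π/8)ln(J∥/J⊥)`); in temperature units (`J = J_phys/T`) an ordering floor
  `T_c ≥ J∥,phys/(3 + ln(J∥/J⊥))`, the interlayer logarithm of the quasi-two-dimensional literature, here
  as a theorem for the comparison model.

Anchors (same file): `klsConstant_one` (`C(1) = latticeGreen 0`, the isotropic threshold),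
`klsConstant_antitone` (`C` is non-increasing in `r`), `latticeGreen_le_klsConstant` and
`klsConstant_le_latticeGreen_div` (`latticeGreen 0 ≤ C(r) ≤ latticeGreen 0 / r` for `0 < r ≤ 1`; the
right inequality is the linear comparison that the logarithm improves for small `r`).

The constants are not sharp: the true asymptotics is `C(r) = (2π)⁻¹ln(1/r) + O(1)` [float; not
proved], against the slope `π/8 ≈ 0.39` proved here (the Gaussian comparison costs `B(s)² ≤ π³/(2s)`
versus the true asymptotics `B(s)² ∼ π/s`), and `C(1) = latticeGreen 0 ≈ 0.5055` [float] against
`1 + π/4`. Proved; no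
named fact; nothing here concerns a quantum model.

## References

* J. Fröhlich, R. Israel, E. H. Lieb, B. Simon, Comm. Math. Phys. 62 (1978) 1–34, Thm. 4.7,
  (4.7)–(4.10) [FILS1978].
* T. Kennedy, E. H. Lieb, B. S. Shastry, J. Stat. Phys. 53 (1988) 1019–1030, eq. (7) [KLS1988JSP].
-/

noncomputable section

open MeasureTheory Set Filter
open scoped BigOperators Real Topology

namespace Literature.Probability.LatticeModels

namespace AnisotropicRotator

open NVectorAniso
open Literature.MathematicalPhysics.QuantumFieldTheory.Balaban1983to89.Beta.PuncturedRiemannSum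

variable {d : ℕ}

/-! ### The one-dimensional factor `B(s) = ∫_{-π}^{π} e^{-s(1 - cos k)} dk` -/

/-- `B(s) = ∫_{-π}^{π} e^{−s(1−cos k)} dk` (`= 2π e^{−s} I₀(s)`, `2π` times the tree's `srwHeatKernel s 0`).
[cite: FILS1978, (4.7) (the one-dimensional factor of ∫dp/E_p in the heat-kernel representation)] -/
def besselFactor (s : ℝ) : ℝ :=
  ∫ k in (-π)..π, Real.exp (-(s * (1 - Real.cos k)))

/-- `B(s) ≥ 0`. [folklore] -/
private theorem besselFactor_nonneg (s : ℝ) : 0 ≤ besselFactor s :=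
  intervalIntegral.integral_nonneg (by linarith [Real.pi_pos]) fun _ _ => (Real.exp_pos _).le

/-- `B(s) ≤ 2π` for `s ≥ 0`. [folklore] -/
private theorem besselFactor_le_two_pi {s : ℝ} (hs : 0 ≤ s) : besselFactor s ≤ 2 * π := by
  have h := integral_exp_neg_mul_one_sub_cos_le hs
  have h1 : (max 1 s) ^ (-(1 / 2 : ℝ)) ≤ 1 :=
    Real.rpow_le_one_of_one_le_of_nonpos (le_max_left _ _) (by norm_num)
  have h2π : (0 : ℝ) ≤ 2 * π := by positivity
  calc besselFactor s ≤ 2 * π * (max 1 s) ^ (-(1 / 2 : ℝ)) := h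
    _ ≤ 2 * π * 1 := mul_le_mul_of_nonneg_left h1 h2π
    _ = 2 * π := mul_one _

/-- `B(s) ≤ 2π s^{-1/2}` for `s ≥ 1` (Gaussian comparison through Jordan's inequality). [folklore] -/
private theorem besselFactor_le_rpow {s : ℝ} (hs : 1 ≤ s) :
    besselFactor s ≤ 2 * π * s ^ (-(1 / 2 : ℝ)) := by
  have h := integral_exp_neg_mul_one_sub_cos_le (by linarith : (0 : ℝ) ≤ s)
  rwa [max_eq_right hs] at h

/-- The Gaussian comparison with its constant: `B(s) ≤ √(π³/(2s))` for `s > 0`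
(`e^{−s(1−cos k)} ≤ e^{−(2s/π²)k²}` on `[-π,π]`, then `∫_ℝ e^{−bk²}dk = √(π/b)`). [folklore] -/
private theorem besselFactor_le_sqrt {s : ℝ} (hs : 0 < s) :
    besselFactor s ≤ Real.sqrt (π ^ 3 / (2 * s)) := by
  have hle : (-π : ℝ) ≤ π := by linarith [Real.pi_pos]
  have hcont : Continuous fun k : ℝ => Real.exp (-(s * (1 - Real.cos k))) := by fun_prop
  set b : ℝ := 2 * s / π ^ 2 with hb
  have hb0 : 0 < b := by positivity
  have hgi := integrable_exp_neg_mul_sq hb0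
  calc besselFactor s ≤ ∫ k in (-π)..π, Real.exp (-b * k ^ 2) := by
        refine intervalIntegral.integral_mono_on hle (hcont.intervalIntegrable _ _)
          hgi.intervalIntegrable fun k hk => ?_
        exact exp_neg_mul_one_sub_cos_le hs.le (abs_le.2 ⟨by linarith [hk.1], hk.2⟩)
    _ ≤ ∫ k, Real.exp (-b * k ^ 2) := by
        rw [intervalIntegral.integral_of_le hle]
        exact setIntegral_le_integral hgi (Eventually.of_forall fun k => (Real.exp_pos _).le)
    _ = Real.sqrt (π / b) := integral_gaussian b
    _ = Real.sqrt (π ^ 3 / (2 * s)) := by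
        congr 1
        rw [hb]
        field_simp

/-- `B(s)² ≤ π³/(2s)` for `s > 0`. [folklore] -/
private theorem besselFactor_sq_le {s : ℝ} (hs : 0 < s) :
    besselFactor s * besselFactor s ≤ π ^ 3 / (2 * s) := by
  have h := besselFactor_le_sqrt hs
  have h0 := besselFactor_nonneg s
  have hnn : 0 ≤ π ^ 3 / (2 * s) := by positivity
  calc besselFactor s * besselFactor s ≤ Real.sqrt (π ^ 3 / (2 * s)) * Real.sqrt (π ^ 3 / (2 * s)) :=
        mul_le_mul h h h0 (Real.sqrt_nonneg _)
    _ = π ^ 3 / (2 * s) := Real.mul_self_sqrt hnn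

/-! ### The product structure of `∫ e^{-tε_K}` and the heat-kernel representation of `∫ dp/ε_K` -/

/-- **Product structure**: `∫_{[-π,π]^d} e^{−tε_K(p)} dp = ∏ᵢ B(tK_i)`. [folklore] -/
private theorem setIntegral_exp_neg_mul_anisoDispersion (t : ℝ) (K : Fin d → ℝ) :
    ∫ p in brillouin d, Real.exp (-(t * anisoDispersion K p)) = ∏ i, besselFactor (t * K i) := by
  have hle : (-π : ℝ) ≤ π := by linarith [Real.pi_pos]
  have hfun : (fun p : Fin d → ℝ => Real.exp (-(t * anisoDispersion K p))) =
      fun p => ∏ i, Real.exp (-(t * K i * (1 - Real.cos (p i)))) := by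
    funext p
    unfold anisoDispersion
    rw [← Real.exp_sum, Finset.mul_sum, ← Finset.sum_neg_distrib]
    congr 1
    exact Finset.sum_congr rfl fun i _ => by ring
  rw [hfun, volume_restrict_brillouin,
    integral_fintype_prod_eq_prod (f := fun i (k : ℝ) => Real.exp (-(t * K i * (1 - Real.cos k))))]
  refine Finset.prod_congr rfl fun i _ => ?_
  rw [besselFactor, intervalIntegral.integral_of_le hle, integral_Icc_eq_integral_Ioc]

/-- `ε_K ≥ m·ε` when `K_i ≥ m`. [folklore] -/
private theorem mul_dispersion_le' {K : Fin d → ℝ} {m : ℝ} (hmK : ∀ i, m ≤ K i) (p : Fin d → ℝ) :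
    m * dispersion p ≤ anisoDispersion K p := by
  unfold dispersion anisoDispersion
  rw [Finset.mul_sum]
  exact Finset.sum_le_sum fun i _ =>
    mul_le_mul_of_nonneg_right (hmK i) (sub_nonneg.2 (Real.cos_le_one _))

/-- `ε_K > 0` on the punctured Brillouin zone (`K_i ≥ m > 0`). [folklore] -/
private theorem anisoDispersion_pos' {K : Fin d → ℝ} {m : ℝ} (hm : 0 < m) (hmK : ∀ i, m ≤ K i)
    {p : Fin d → ℝ} (hp : p ∈ brillouin d) (hp0 : p ≠ 0) : 0 < anisoDispersion K p :=
  lt_of_lt_of_le (mul_pos hm (dispersion_pos_of_mem_brillouin hp hp0)) (mul_dispersion_le' hmK p)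

/-- `ε_K` is continuous. [folklore] -/
private theorem continuous_anisoDispersion' (K : Fin d → ℝ) :
    Continuous fun p : Fin d → ℝ => anisoDispersion K p := by
  unfold anisoDispersion
  fun_prop

/-- `1/ε_K` is integrable on the Brillouin zone (`d ≥ 3`, `K_i ≥ m > 0`), by comparison with `1/ε`.
[folklore] -/
private theorem integrableOn_inv_anisoDispersion (hd : 3 ≤ d) {K : Fin d → ℝ} {m : ℝ} (hm : 0 < m)
    (hmK : ∀ i, m ≤ K i) :
    IntegrableOn (fun p : Fin d → ℝ => (anisoDispersion K p)⁻¹) (brillouin d) volume := by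
  have hcont : ContinuousOn (fun p : Fin d → ℝ => 1 / anisoDispersion K p) (brillouin d \ {0}) :=
    continuousOn_const.div (continuous_anisoDispersion' K).continuousOn fun _ hp =>
      (anisoDispersion_pos' hm hmK hp.1 hp.2).ne'
  have hB : ∀ p ∈ brillouin d, p ≠ 0 → ‖1 / anisoDispersion K p‖ ≤ 0 + (1 / m) / dispersion p := by
    intro p hp hp0
    have hε := dispersion_pos_of_mem_brillouin hp hp0
    have hεK := anisoDispersion_pos' hm hmK hp hp0
    rw [Real.norm_eq_abs, abs_of_pos (one_div_pos.2 hεK), zero_add, div_div]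
    exact one_div_le_one_div_of_le (mul_pos hm hε) (mul_dispersion_le' hmK p)
  have h := integrableOn_brillouin_of_norm_le_inv_dispersion hd hcont hB
  exact h.congr_fun (fun p _ => one_div _) (measurableSet_brillouin d)

/-- **The heat-kernel representation of FILS's integral** (`d ≥ 3`, `K_i ≥ m > 0`):
`∫_{[-π,π]^d} dp/ε_K(p) = ∫₀^∞ ∏ᵢ B(tK_i) dt`, the integrand being integrable on `(0,∞)`
(`1/ε_K = ∫₀^∞ e^{−tε_K}dt` off the origin, Fubini–Tonelli against the integrable majorant `e^{−tε_K}`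
whose double integral is `∫dp/ε_K < ∞`, and the product structure). [cite: FILS1978, (4.7)] -/
theorem setIntegral_inv_anisoDispersion_eq (hd : 3 ≤ d) {K : Fin d → ℝ} {m : ℝ} (hm : 0 < m)
    (hmK : ∀ i, m ≤ K i) :
    IntegrableOn (fun t : ℝ => ∏ i, besselFactor (t * K i)) (Ioi 0) ∧
      ∫ p in brillouin d, 1 / anisoDispersion K p =
        ∫ t in Ioi (0 : ℝ), ∏ i, besselFactor (t * K i) := by
  set μ : Measure (Fin d → ℝ) := volume.restrict (brillouin d) with hμ
  set ν : Measure ℝ := volume.restrict (Ioi (0 : ℝ)) with hν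
  set G : (Fin d → ℝ) × ℝ → ℝ := fun q => Real.exp (-(q.2 * anisoDispersion K q.1)) with hG
  have hεc : Continuous (fun p : Fin d → ℝ => anisoDispersion K p) := continuous_anisoDispersion' K
  have hG_cont : Continuous G :=
    Real.continuous_exp.comp ((continuous_snd.mul (hεc.comp continuous_fst)).neg)
  have hG_meas : AEStronglyMeasurable G (μ.prod ν) := hG_cont.aestronglyMeasurable
  have hB : MeasurableSet (brillouin d) := measurableSet_brillouin d
  haveI : Nonempty (Fin d) := ⟨⟨0, by omega⟩⟩
  -- `ε_K > 0` almost everywhere on the Brillouin zone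
  have hε_pos : ∀ᵐ p ∂μ, 0 < anisoDispersion K p := by
    have h_ne : ∀ᵐ p ∂μ, p ≠ (0 : Fin d → ℝ) := by
      have h0 : μ {(0 : Fin d → ℝ)} = 0 := by
        rw [hμ, Measure.restrict_apply (measurableSet_singleton 0)]
        exact measure_mono_null Set.inter_subset_left (measure_singleton 0)
      filter_upwards [measure_eq_zero_iff_ae_notMem.1 h0] with p hp
      simpa using hp
    filter_upwards [ae_restrict_mem hB, h_ne] with p hp hp0
    exact anisoDispersion_pos' hm hmK hp hp0
  -- the `t`-integrals for fixed `p`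
  have hGp : ∀ p, 0 < anisoDispersion K p →
      Integrable (fun t => G (p, t)) ν ∧ ∫ t, G (p, t) ∂ν = (anisoDispersion K p)⁻¹ :=
    fun p hp => integral_exp_neg_mul_Ioi' hp
  -- integrability of `G` on the product: the absolute double integral is `∫ dp/ε_K(p)`
  have hinv : IntegrableOn (fun p : Fin d → ℝ => (anisoDispersion K p)⁻¹) (brillouin d) :=
    integrableOn_inv_anisoDispersion hd hm hmK
  have hGint : Integrable G (μ.prod ν) := by
    rw [integrable_prod_iff hG_meas]
    refine ⟨?_, ?_⟩
    · filter_upwards [hε_pos] with p hp using (hGp p hp).1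
    · refine (hinv.congr ?_)
      filter_upwards [hε_pos] with p hp
      rw [← (hGp p hp).2]
      refine integral_congr_ae (Eventually.of_forall fun t => ?_)
      simp only [hG, Real.norm_eq_abs, Real.abs_exp]
  -- the inner `p`-integral for fixed `t` is the product of the one-dimensional factors
  have hinner : ∀ t : ℝ, ∫ p, G (p, t) ∂μ = ∏ i, besselFactor (t * K i) := by
    intro t
    simp only [hG, hμ]
    exact setIntegral_exp_neg_mul_anisoDispersion t K
  refine ⟨?_, ?_⟩
  · have h := hGint.integral_prod_right
    exact h.congr (Eventually.of_forall fun t => hinner t)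
  · have hG1 : ∫ p in brillouin d, 1 / anisoDispersion K p = ∫ p, ∫ t, G (p, t) ∂ν ∂μ := by
      refine integral_congr_ae ?_
      filter_upwards [hε_pos] with p hp
      rw [(hGp p hp).2, one_div]
    rw [hG1, integral_integral_swap hGint]
    exact integral_congr_ae (ae_of_all _ fun t => hinner t)

/-! ### `C(r) ≤ 3 + ln(1/r)` -/

/-- `C(r)` in heat-kernel form: `C(r) = (2π)⁻³ ∫₀^∞ B(t)²B(rt) dt`, with integrability (`r > 0`).
[cite: FILS1978, (4.7)] [cite: KLS1988JSP, eq. (7)] -/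
theorem klsConstant_eq_integral {r : ℝ} (hr : 0 < r) :
    IntegrableOn (fun t : ℝ => besselFactor t * besselFactor t * besselFactor (t * r)) (Ioi 0) ∧
      klsConstant r = ((2 * π) ^ 3)⁻¹ *
        ∫ t in Ioi (0 : ℝ), besselFactor t * besselFactor t * besselFactor (t * r) := by
  have hm : 0 < min 1 r := lt_min one_pos hr
  have hmK : ∀ i, min 1 r ≤ layeredCoupling 1 r i := fun i => by
    unfold layeredCoupling
    split_ifs
    · exact min_le_right _ _
    · exact min_le_left _ _
  obtain ⟨hI, hrep⟩ := setIntegral_inv_anisoDispersion_eq (d := 3) le_rfl hm hmK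
  have hprod : ∀ t : ℝ, ∏ i : Fin 3, besselFactor (t * layeredCoupling 1 r i) =
      besselFactor t * besselFactor t * besselFactor (t * r) := by
    intro t
    have h0 : layeredCoupling 1 r 0 = 1 := if_neg (by decide)
    have h1 : layeredCoupling 1 r 1 = 1 := if_neg (by decide)
    have h2 : layeredCoupling 1 r 2 = r := if_pos rfl
    rw [Fin.prod_univ_three, h0, h1, h2, mul_one]
  simp_rw [hprod] at hI hrep
  refine ⟨hI, ?_⟩
  have hC : klsConstant r = infraredConstant (layeredCoupling 1 r) := by
    rw [infraredConstant_layeredCoupling one_ne_zero, div_one, div_one]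
  rw [hC, infraredConstant, hrep]

/-- **`C(r) ≤ 1 + π/4 + (π/8)ln(1/r)` for `0 < r ≤ 1`** — an explicit logarithmic bound on FILS's
constant `(2π)⁻³∫d³q/E^r_q` for Kennedy–Lieb–Shastry's layered dispersion: split `∫₀^∞ B(t)²B(rt)dt`
at `t = 1` and `t = 1/r` and use `B ≤ 2π`, `B(s)² ≤ π³/(2s)`, `B(s) ≤ 2πs^{-1/2}` (`s ≥ 1`): the three
pieces are at most `(2π)³·1`, `(2π)³·(π/8)ln(1/r)`, `(2π)³·π/4`. [cite: FILS1978, (4.7)] [cite: KLS1988JSP, eq. (7)] -/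
theorem klsConstant_le_sharp {r : ℝ} (hr : 0 < r) (hr1 : r ≤ 1) :
    klsConstant r ≤ 1 + π / 4 + π / 8 * Real.log (1 / r) := by
  obtain ⟨hI, hrep⟩ := klsConstant_eq_integral hr
  set F : ℝ → ℝ := fun t => besselFactor t * besselFactor t * besselFactor (t * r) with hF
  set R : ℝ := 1 / r with hR
  have hR1 : 1 ≤ R := by rw [hR, le_div_iff₀ hr]; linarith
  have hR0 : 0 < R := by positivity
  have hRr : R * r = 1 := by rw [hR]; field_simp
  have hc : (0 : ℝ) < (2 * π) ^ 3 := by positivity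
  have h2π : (0 : ℝ) ≤ 2 * π := by positivity
  have hπ := Real.pi_pos
  -- pointwise bounds
  have hb1 : ∀ t ∈ Ioc (0 : ℝ) 1, F t ≤ (2 * π) ^ 3 := by
    intro t ht
    have h1 := besselFactor_le_two_pi ht.1.le
    have h3 := besselFactor_le_two_pi (mul_nonneg ht.1.le hr.le)
    calc F t = besselFactor t * besselFactor t * besselFactor (t * r) := rfl
      _ ≤ 2 * π * (2 * π) * (2 * π) :=
          mul_le_mul (mul_le_mul h1 h1 (besselFactor_nonneg _) h2π) h3 (besselFactor_nonneg _)
            (by positivity)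
      _ = (2 * π) ^ 3 := by ring
  have hb2 : ∀ t ∈ Ioc (1 : ℝ) R, F t ≤ (2 * π) ^ 3 * (π / 8 * t⁻¹) := by
    intro t ht
    have ht0 : 0 < t := by linarith [ht.1]
    have h3 := besselFactor_le_two_pi (by positivity : 0 ≤ t * r)
    calc F t = besselFactor t * besselFactor t * besselFactor (t * r) := rfl
      _ ≤ π ^ 3 / (2 * t) * (2 * π) :=
          mul_le_mul (besselFactor_sq_le ht0) h3 (besselFactor_nonneg _) (by positivity)
      _ = (2 * π) ^ 3 * (π / 8 * t⁻¹) := by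
          field_simp
          ring
  have hb3 : ∀ t ∈ Ioi R, F t ≤ (2 * π) ^ 3 * (π / 8 * (r ^ (-(1 / 2 : ℝ)) * t ^ (-(3 / 2 : ℝ)))) := by
    intro t ht
    have ht1 : 1 < t := lt_of_le_of_lt hR1 ht
    have ht0 : 0 < t := by linarith
    have htr : 1 ≤ t * r := by
      have : R * r < t * r := mul_lt_mul_of_pos_right ht hr
      linarith
    have h3 := besselFactor_le_rpow htr
    have hpow : (2 * t)⁻¹ * (t * r) ^ (-(1 / 2 : ℝ)) =
        (1 / 2) * (r ^ (-(1 / 2 : ℝ)) * t ^ (-(3 / 2 : ℝ))) := by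
      rw [Real.mul_rpow ht0.le hr.le, mul_inv, ← Real.rpow_neg_one t,
        show (-(3 / 2 : ℝ)) = -1 + -(1 / 2) by norm_num, Real.rpow_add ht0]
      ring
    calc F t = besselFactor t * besselFactor t * besselFactor (t * r) := rfl
      _ ≤ π ^ 3 / (2 * t) * (2 * π * (t * r) ^ (-(1 / 2 : ℝ))) :=
          mul_le_mul (besselFactor_sq_le ht0) h3 (besselFactor_nonneg _) (by positivity)
      _ = 2 * π ^ 4 * ((2 * t)⁻¹ * (t * r) ^ (-(1 / 2 : ℝ))) := by ring
      _ = (2 * π) ^ 3 * (π / 8 * (r ^ (-(1 / 2 : ℝ)) * t ^ (-(3 / 2 : ℝ)))) := by rw [hpow]; ring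
  -- the three pieces
  have hI1 : IntegrableOn F (Ioc 0 1) := hI.mono_set Ioc_subset_Ioi_self
  have hI2 : IntegrableOn F (Ioc 1 R) :=
    hI.mono_set (Ioc_subset_Ioi_self.trans (Ioi_subset_Ioi zero_le_one))
  have hI3 : IntegrableOn F (Ioi R) := hI.mono_set (Ioi_subset_Ioi hR0.le)
  have hP1 : ∫ t in Ioc 0 1, F t ≤ (2 * π) ^ 3 := by
    calc ∫ t in Ioc 0 1, F t ≤ ∫ _ in Ioc (0 : ℝ) 1, (2 * π) ^ 3 :=
          setIntegral_mono_on hI1 (integrableOn_const (by simp [Real.volume_Ioc]))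
            measurableSet_Ioc hb1
      _ = (2 * π) ^ 3 := by
          rw [setIntegral_const, smul_eq_mul, measureReal_def, Real.volume_Ioc,
            ENNReal.toReal_ofReal (by norm_num)]
          ring
  have hinvI : IntegrableOn (fun t : ℝ => (2 * π) ^ 3 * (π / 8 * t⁻¹)) (Ioc 1 R) := by
    refine ((continuousOn_const.mul (continuousOn_const.mul (continuousOn_inv₀.mono ?_))).integrableOn_compact
      isCompact_Icc).mono_set Ioc_subset_Icc_self
    intro t ht
    exact ne_of_gt (lt_of_lt_of_le zero_lt_one ht.1)
  have hP2 : ∫ t in Ioc 1 R, F t ≤ (2 * π) ^ 3 * (π / 8 * Real.log (1 / r)) := by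
    calc ∫ t in Ioc 1 R, F t ≤ ∫ t in Ioc 1 R, (2 * π) ^ 3 * (π / 8 * t⁻¹) :=
          setIntegral_mono_on hI2 hinvI measurableSet_Ioc hb2
      _ = (2 * π) ^ 3 * (π / 8 * Real.log (1 / r)) := by
          rw [integral_const_mul, integral_const_mul, ← intervalIntegral.integral_of_le hR1,
            integral_inv_of_pos one_pos hR0, div_one]
  have hrpowI : IntegrableOn (fun t : ℝ => t ^ (-(3 / 2 : ℝ))) (Ioi R) :=
    integrableOn_Ioi_rpow_of_lt (by norm_num) hR0
  have hP3 : ∫ t in Ioi R, F t ≤ (2 * π) ^ 3 * (π / 4) := by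
    have hval : ∫ t in Ioi R, t ^ (-(3 / 2 : ℝ)) = 2 * R ^ (-(1 / 2 : ℝ)) := by
      rw [integral_Ioi_rpow_of_lt (by norm_num) hR0]
      rw [show (-(3 / 2 : ℝ)) + 1 = -(1 / 2) by norm_num]
      ring
    have hRpow : r ^ (-(1 / 2 : ℝ)) * R ^ (-(1 / 2 : ℝ)) = 1 := by
      rw [← Real.mul_rpow hr.le hR0.le, mul_comm r R, hRr, Real.one_rpow]
    calc ∫ t in Ioi R, F t
        ≤ ∫ t in Ioi R, (2 * π) ^ 3 * (π / 8 * (r ^ (-(1 / 2 : ℝ)) * t ^ (-(3 / 2 : ℝ)))) :=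
          setIntegral_mono_on hI3 (((hrpowI.const_mul _).const_mul _).const_mul _) measurableSet_Ioi hb3
      _ = (2 * π) ^ 3 * (π / 8 * (r ^ (-(1 / 2 : ℝ)) * (2 * R ^ (-(1 / 2 : ℝ))))) := by
          rw [integral_const_mul, integral_const_mul, integral_const_mul, hval]
      _ = (2 * π) ^ 3 * (π / 4) := by
          rw [show r ^ (-(1 / 2 : ℝ)) * (2 * R ^ (-(1 / 2 : ℝ))) =
            2 * (r ^ (-(1 / 2 : ℝ)) * R ^ (-(1 / 2 : ℝ))) by ring, hRpow]
          ring
  -- assembling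
  have hsplit : ∫ t in Ioi 0, F t =
      (∫ t in Ioc 0 1, F t) + (∫ t in Ioc 1 R, F t) + ∫ t in Ioi R, F t := by
    rw [← setIntegral_union (Set.Ioc_disjoint_Ioc.2 (by simp [hR1])) measurableSet_Ioc hI1 hI2,
      Set.Ioc_union_Ioc_eq_Ioc zero_le_one hR1,
      ← setIntegral_union (Set.Ioc_disjoint_Ioi (le_refl R)) measurableSet_Ioi
        (hI.mono_set Ioc_subset_Ioi_self) hI3,
      Set.Ioc_union_Ioi_eq_Ioi hR0.le]
  have htot : ∫ t in Ioi 0, F t ≤ (2 * π) ^ 3 * (1 + π / 4 + π / 8 * Real.log (1 / r)) := by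
    rw [hsplit]
    nlinarith [hP1, hP2, hP3]
  rw [hrep]
  calc ((2 * π) ^ 3)⁻¹ * ∫ t in Ioi 0, F t
      ≤ ((2 * π) ^ 3)⁻¹ * ((2 * π) ^ 3 * (1 + π / 4 + π / 8 * Real.log (1 / r))) :=
        mul_le_mul_of_nonneg_left htot (inv_nonneg.2 hc.le)
    _ = 1 + π / 4 + π / 8 * Real.log (1 / r) := by field_simp

/-- **`C(r) ≤ 3 + ln(1/r)` for `0 < r ≤ 1`** (the round form of `klsConstant_le_sharp`: `1 + π/4 ≤ 3`,
`π/8 ≤ 1`, `ln(1/r) ≥ 0`). [cite: FILS1978, (4.7)] [cite: KLS1988JSP, eq. (7)] -/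
theorem klsConstant_le {r : ℝ} (hr : 0 < r) (hr1 : r ≤ 1) :
    klsConstant r ≤ 3 + Real.log (1 / r) := by
  have h := klsConstant_le_sharp hr hr1
  have hlog : 0 ≤ Real.log (1 / r) := Real.log_nonneg (by rw [le_div_iff₀ hr]; linarith)
  nlinarith [Real.pi_le_four, Real.pi_pos]

/-- **The explicit interlayer ordering floor**: for `0 < J⊥ ≤ J∥` and `ε > 0`, for all large even `L`,
the layered classical XY model on `(ℤ/Lℤ)³` has
`L⁻⁶∑_{x,y}⟨cos(θ_x − θ_y)⟩_{(J∥,J∥,J⊥)} ≥ 1 − (3 + ln(J∥/J⊥))/J∥ − ε` — long-range order as soon as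
`J∥ > 3 + ln(J∥/J⊥)` (Fröhlich–Israel–Lieb–Simon's criterion (4.9)–(4.10) with `C₀ ≤ 3 + ln(J∥/J⊥)`
for the reflection-positive layered coupling). [cite: FILS1978, Thm. 4.7 with (4.7)–(4.10)] [cite: KLS1988JSP, eqs. (5)–(7)] -/
theorem layered_longRangeOrder_explicit {Jpar Jperp : ℝ} (hperp : 0 < Jperp) (hle : Jperp ≤ Jpar)
    {ε : ℝ} (hε : 0 < ε) :
    ∃ L₀ : ℕ, ∀ (L : ℕ) [NeZero L], L₀ ≤ L → Even L → 4 ≤ L →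
      1 - (3 + Real.log (Jpar / Jperp)) / Jpar - ε ≤ plateau L (layeredCoupling Jpar Jperp) := by
  have hpar : 0 < Jpar := hperp.trans_le hle
  obtain ⟨L₀, hL₀⟩ := layered_longRangeOrder_infraredBound hpar hperp hε
  refine ⟨L₀, fun L _ hL hLe hL4 => ?_⟩
  have h := hL₀ L hL hLe hL4
  have hC : klsConstant (Jperp / Jpar) ≤ 3 + Real.log (Jpar / Jperp) := by
    have h1 := klsConstant_le (div_pos hperp hpar) ((div_le_one hpar).2 hle)
    rwa [one_div_div] at h1
  have hdiv : klsConstant (Jperp / Jpar) / Jpar ≤ (3 + Real.log (Jpar / Jperp)) / Jpar :=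
    div_le_div_of_nonneg_right hC hpar.le
  linarith


/-- The same floor with the sharper constant of `klsConstant_le_sharp`: for `0 < J⊥ ≤ J∥` and `ε > 0`,
for all large even `L`, plateau `≥ 1 − (1 + π/4 + (π/8)ln(J∥/J⊥))/J∥ − ε` — long-range order once
`J∥ > 1 + π/4 + (π/8)ln(J∥/J⊥)`. [cite: FILS1978, Thm. 4.7 with (4.7)–(4.10)] [cite: KLS1988JSP, eqs. (5)–(7)] -/
theorem layered_longRangeOrder_explicit_sharp {Jpar Jperp : ℝ} (hperp : 0 < Jperp) (hle : Jperp ≤ Jpar)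
    {ε : ℝ} (hε : 0 < ε) :
    ∃ L₀ : ℕ, ∀ (L : ℕ) [NeZero L], L₀ ≤ L → Even L → 4 ≤ L →
      1 - (1 + π / 4 + π / 8 * Real.log (Jpar / Jperp)) / Jpar - ε ≤
        plateau L (layeredCoupling Jpar Jperp) := by
  have hpar : 0 < Jpar := hperp.trans_le hle
  obtain ⟨L₀, hL₀⟩ := layered_longRangeOrder_infraredBound hpar hperp hε
  refine ⟨L₀, fun L _ hL hLe hL4 => ?_⟩
  have h := hL₀ L hL hLe hL4
  have hC : klsConstant (Jperp / Jpar) ≤ 1 + π / 4 + π / 8 * Real.log (Jpar / Jperp) := by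
    have h1 := klsConstant_le_sharp (div_pos hperp hpar) ((div_le_one hpar).2 hle)
    rwa [one_div_div] at h1
  have hdiv : klsConstant (Jperp / Jpar) / Jpar ≤ (1 + π / 4 + π / 8 * Real.log (Jpar / Jperp)) / Jpar :=
    div_le_div_of_nonneg_right hC hpar.le
  linarith

/-! ### Anchors: `C(1) = latticeGreen 0`, monotonicity in `r`, and `C(r) ≤ latticeGreen 0 / r` -/

/-- `E^1_q = ε(q)`: at `r = 1` Kennedy–Lieb–Shastry's dispersion is the isotropic one. [cite: KLS1988JSP, eq. (7)] -/
theorem klsDispersion_one (q : Fin 3 → ℝ) : klsDispersion 1 q = dispersion q := by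
  unfold klsDispersion dispersion
  rw [Fin.sum_univ_three]
  ring

/-- **`C(1) = latticeGreen 0`** (`= J₀ ≈ 0.5055` [float], the isotropic threshold of
`FriedliVelenik2017_thm1025_planeRotator3_holds`). [cite: FILS1978, (4.7)] [cite: KLS1988JSP, eq. (7)] -/
theorem klsConstant_one : klsConstant 1 = latticeGreen (0 : Site 3) := by
  unfold klsConstant latticeGreen
  simp_rw [klsDispersion_one]
  have h0 : ∀ p : Fin 3 → ℝ, Real.cos (∑ i, p i * (((0 : Site 3) i : ℤ) : ℝ)) = 1 := by
    intro p
    simp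
  simp_rw [h0]
  rw [div_eq_inv_mul]

/-- `E^r_q` is `ε_{(1,1,r)}(q)`. [cite: KLS1988JSP, eq. (7)] -/
private theorem klsDispersion_eq_anisoDispersion (r : ℝ) (q : Fin 3 → ℝ) :
    klsDispersion r q = anisoDispersion (layeredCoupling 1 r) q := by
  rw [anisoDispersion_layeredCoupling one_ne_zero, div_one, one_mul]

/-- `1/E^r_q` is integrable on the Brillouin zone for `r > 0`. [folklore] -/
private theorem integrableOn_inv_klsDispersion {r : ℝ} (hr : 0 < r) :
    IntegrableOn (fun q : Fin 3 → ℝ => 1 / klsDispersion r q) (brillouin 3) volume := by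
  have hm : 0 < min 1 r := lt_min one_pos hr
  have hmK : ∀ i, min 1 r ≤ layeredCoupling 1 r i := fun i => by
    unfold layeredCoupling
    split_ifs
    · exact min_le_right _ _
    · exact min_le_left _ _
  have h := integrableOn_inv_anisoDispersion (d := 3) le_rfl hm hmK
  refine h.congr_fun (fun q _ => ?_) (measurableSet_brillouin 3)
  rw [klsDispersion_eq_anisoDispersion, one_div]

/-- `E^r_q` is non-decreasing in `r`, hence **`C(r)` is non-increasing in `r`** (`0 < r ≤ r'`).
[cite: KLS1988JSP, eq. (7)] -/
theorem klsConstant_antitone {r r' : ℝ} (hr : 0 < r) (hrr' : r ≤ r') : klsConstant r' ≤ klsConstant r := by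
  unfold klsConstant
  have hc : (0 : ℝ) ≤ ((2 * π) ^ 3)⁻¹ := by positivity
  refine mul_le_mul_of_nonneg_left ?_ hc
  refine setIntegral_mono_on (integrableOn_inv_klsDispersion (hr.trans_le hrr'))
    (integrableOn_inv_klsDispersion hr) (measurableSet_brillouin 3) fun q _ => ?_
  have hle : klsDispersion r q ≤ klsDispersion r' q := by
    unfold klsDispersion
    nlinarith [Real.cos_le_one (q 2)]
  rcases (klsDispersion_nonneg hr.le q).eq_or_lt with h0 | hpos
  · -- `E^r_q = 0` forces `cos q₃ = 1`, so `E^{r'}_q = E^r_q` and there is nothing to compare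
    have h0' : klsDispersion r q = 0 := h0.symm
    have hc2 : r * (1 - Real.cos (q 2)) = 0 := by
      unfold klsDispersion at h0'
      nlinarith [Real.cos_le_one (q 0), Real.cos_le_one (q 1),
        mul_nonneg hr.le (sub_nonneg.2 (Real.cos_le_one (q 2)))]
    have h3 : 1 - Real.cos (q 2) = 0 := by
      rcases mul_eq_zero.1 hc2 with h | h
      · exact absurd h hr.ne'
      · exact h
    have heq : klsDispersion r' q = klsDispersion r q := by
      unfold klsDispersion
      rw [h3, mul_zero, mul_zero]
    rw [heq]
  · exact one_div_le_one_div_of_le hpos hle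

/-- **`latticeGreen 0 ≤ C(r)` for `0 < r ≤ 1`** (the anisotropic threshold is never below the
isotropic one). [cite: FILS1978, (4.7)] [cite: KLS1988JSP, eq. (7)] -/
theorem latticeGreen_le_klsConstant {r : ℝ} (hr : 0 < r) (hr1 : r ≤ 1) :
    latticeGreen (0 : Site 3) ≤ klsConstant r := by
  rw [← klsConstant_one]
  exact klsConstant_antitone hr hr1

/-- **`C(r) ≤ latticeGreen 0 / r` for `0 < r ≤ 1`** (`E^r_q ≥ r·ε(q)`): the linear comparison, which
`klsConstant_le` improves to a logarithm for small `r`. [cite: FILS1978, (4.7)] [cite: KLS1988JSP, eq. (7)] -/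
theorem klsConstant_le_latticeGreen_div {r : ℝ} (hr : 0 < r) (hr1 : r ≤ 1) :
    klsConstant r ≤ latticeGreen (0 : Site 3) / r := by
  rw [← klsConstant_one, klsConstant, klsConstant, mul_div_assoc]
  have hc : (0 : ℝ) ≤ ((2 * π) ^ 3)⁻¹ := by positivity
  refine mul_le_mul_of_nonneg_left ?_ hc
  rw [div_eq_mul_inv, ← smul_eq_mul, ← integral_smul_const]
  simp_rw [smul_eq_mul]
  refine setIntegral_mono_on (integrableOn_inv_klsDispersion hr)
    ((integrableOn_inv_klsDispersion one_pos).mul_const _) (measurableSet_brillouin 3) fun q _ => ?_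
  have hle : r * klsDispersion 1 q ≤ klsDispersion r q := by
    unfold klsDispersion
    nlinarith [Real.cos_le_one (q 0), Real.cos_le_one (q 1), Real.cos_le_one (q 2)]
  rcases (klsDispersion_nonneg zero_le_one q).eq_or_lt with h0 | hpos
  · have h1' : klsDispersion 1 q = 0 := h0.symm
    have hz : klsDispersion r q = 0 := by
      have hle' : klsDispersion r q ≤ klsDispersion 1 q := by
        unfold klsDispersion
        nlinarith [Real.cos_le_one (q 2)]
      exact le_antisymm (hle'.trans h1'.le) (klsDispersion_nonneg hr.le q)
    rw [hz, h1']
    simp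
  · calc 1 / klsDispersion r q ≤ 1 / (r * klsDispersion 1 q) :=
        one_div_le_one_div_of_le (mul_pos hr hpos) hle
      _ = 1 / klsDispersion 1 q * r⁻¹ := by field_simp

end AnisotropicRotator

end Literature.Probability.LatticeModels
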